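import Literature.MathematicalPhysics.QuantumLattice.SchwartzKernelLocal
import Literature.MathematicalPhysics.QuantumLattice.OSMomentBounds
import HarnessLib

/-!
# The Schwartz kernel theorem for multilinear forms, II: the global functional and the Schwinger functions of a measure

Trunk **T-AQFT** (topic `MathematicalPhysics/QuantumLattice`), families `constructive-qft`,
`crit-ising`; the second proofs file of the Schwartz kernel (nuclear) theorem, continuing
`SchwartzKernelLocal`, in the decomposition of the bridge `Literature.MathematicalPhysics.QuantumLattice.IsOSMeasure.exists_isOSFamily`.

Discharged named fact:

* `Literature.MathematicalPhysics.QuantumLattice.existsUnique_schwingerFamilyOf` (`SchwartzTensor`; Glimm–Jaffe §6.1, Prop. 6.1.4;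
  OS 1973 §3; kernel theorem, Reed–Simon I Thm V.12): a probability law on `𝒮'(E)`, `E`
  finite-dimensional, with all moments and jointly continuous moment functionals has a unique
  Schwinger family `𝔖ₙ ∈ 𝒮'(Eⁿ)` with `𝔖ₙ(f₁ ⊗ ⋯ ⊗ fₙ) = ∫ ∏ᵢ ω(fᵢ) dμ` —
  `existsUnique_schwingerFamilyOf_holds`.

Main intermediate result, the **Schwartz kernel theorem for multilinear forms**
(`existsUnique_schwartzKernel`, real form
`existsUnique_schwartzKernel_real`): every jointly continuous complex `n`-linear
form `M` on `𝓢(E, ℂ)ⁿ` is `M(g₁, …, gₙ) = T(g₁ ⊗ ⋯ ⊗ gₙ)` for a unique continuous linear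
functional `T` on `𝓢(Eⁿ, ℂ)` (Reed–Simon I, Thm V.12 for bilinear forms on `𝒮(ℝⁿ) × 𝒮(ℝᵐ)`,
extended to multilinear forms in Problem 35 of Ch. V).

## Proof (global step)

Fix coordinates `Λ : E ≃L[ℝ] ℝᵐ`, the reference box `B₀` (`refBox`: outer `[-3, 3]`, inner
`[-2, 2]` in every coordinate) and the lattice partition of unity `∑_{β ∈ ℤᵐ} η_β = 1` of
`SchwartzPartition` (`η_β = η₀(· - Λ⁻¹β)` supported in `{|Λ(·)_c - β_c| ≤ 1}`). For a multi-index
`n ∈ ℤ^{n×m}` with blocks `n⌊i ∈ ℤᵐ` let `a(n) ∈ Eⁿ`, `a(n)ᵢ = Λ⁻¹(n⌊i)` (`latVec`). Set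
`T(F) = ∑ₙ T_{B₀}[M ∘ τ_{a(n)}](χ₀ · F(· + a(n)))` (`kernelTerm`, `kernelFunctional`), where
`χ₀(v) = ∏ᵢ η₀(vᵢ)` (`cutoffPi`), `M ∘ τ_a` is the translated form `h ↦ M(h₁(· - a₁), …)`
(`translateForm`) and `T_{B₀}[·]` the local functional of `SchwartzKernelLocal`. Convergence and
continuity (`kernelTerm_bound`): the translated forms are bounded by a fixed finite family of
seminorms with constant `O((1 + ‖a‖)^k)` (`exists_isBoundedBySeminorms_translateForm`, from
`exists_bound_seminorm_compSubConstCLM`), the local functionals are uniformly bounded for such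
forms (`norm_boxFunctional_le`), and the localised translates `χ₀ · F(· + a)` decay faster than
any power of `‖a‖` in every seminorm (`exists_bound_sup_seminorm_smulLeftCLM_compSubConstCLM`);
the excess decay `(1 + ‖a(n)‖)^{-2nm}` is dominated by the summable weights `∏ (1 + |n_{ic}|)⁻²`
(`one_le_weight_mul`). On a tensor product, `χ₀ · (⊗g)(· + a) = ⊗ᵢ (η₀ · gᵢ(· + aᵢ))` is a tensor
product supported in the inner box, so by the local reproduction `boxFunctional_tensorFin` and
translating back, `Tₙ(⊗g) = M(η_{n⌊1} g₁, …, η_{n⌊n} gₙ)` (`kernelTerm_tensorFin`); summing over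
the block-cubes and using multilinearity, the partial sums are `M(W_R g₁, …, W_R gₙ)` with the
windows `W_R = ∑_{|β| ≤ R} η_β` (`sum_kernelTerm_tensorFin`), which tend to `M(g)` since
`W_R g → g` in `𝓢` (`tendsto_latticeWindow_smul`) and `M` is continuous: `T(⊗g) = M(g)`
(`kernelFunctional_tensorFin`). Uniqueness of `T` is the density of the span of tensor products
(`denseSpan_tensorProducts_holds`). For the Schwinger functions, the moment functionals
`(f₁, …, fₙ) ↦ ∫ ∏ᵢ ω(fᵢ) dμ` are real multilinear (`momentMultilinear`) and continuous by
hypothesis; complexify (`multilinearComplexify`, `SchwartzMultilinear`) and apply the theorem.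

## Sources

* M. Reed, B. Simon, *Methods of Modern Mathematical Physics I*, §V.3 Thm V.12 and Problem V.35
  [ReedSimonI1980] — the statement.
* J. Glimm, A. Jaffe, *Quantum Physics* (2nd ed.), §6.1 Prop. 6.1.4 [GlimmJaffeQP1987];
  K. Osterwalder, R. Schrader, Comm. Math. Phys. 31 (1973), §3 [OsterwalderSchraderCMP1973] — the
  Schwinger functions of a measure / as distributions.
* The partition-of-unity globalisation of the Fourier-series construction is textbook folklore;
  the proofs are self-contained on top of Mathlib and the tree.

## Mathlib and Literature

Used from Mathlib: `SchwartzMap.mkCLMtoNormedSpace`, `SchwartzMap.smulLeftCLM` (`_sum`,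
`tsupport_smulLeftCLM_subset`), `SchwartzMap.compSubConstCLM`, `HasCompactSupport.hasTemperateGrowth`,
`MultilinearMap.compLinearMap`, `MultilinearMap.map_sum_finset`, `toEuclidean`,
`tendsto_nhds_unique`, `Finset.prod_update_of_mem`, `MeasureTheory.integral_add` /
`integral_const_mul`. From the tree: `BoxData.boxFunctional`, `boxFunctional_tensorFin`
(`SchwartzKernelLocal`); `latticeBump`, `latticeWindow`, `tendsto_latticeWindow_smul`,
`exists_bound_seminorm_compSubConstCLM`, `exists_bound_sup_seminorm_smulLeftCLM_compSubConstCLM`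
(`SchwartzPartition`); `multilinearComplexify`, `MultilinearMap.exists_isBoundedBySeminorms`
(`SchwartzMultilinear`); `denseSpan_tensorProducts_holds`, `IsSchwingerFamilyOf.unique`,
`abs_coord_le` (`SchwartzTensorDensityProofs`); `HasAllMoments.integrable_prod` (`OSMomentBounds`).
-/

open scoped SchwartzMap Real FourierTransform Topology ContDiff
open Filter Set Complex

noncomputable section

namespace Literature.MathematicalPhysics.QuantumLattice

/-! ### D. The reference box, lattice vectors, translated forms and localisation -/

section Global

variable {E : Type*} [NormedAddCommGroup E] [NormedSpace ℝ E] [FiniteDimensional ℝ E]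
variable {m n : ℕ} (Λ : E ≃L[ℝ] EuclideanSpace ℝ (Fin m))

/-- The reference box: outer box `[-3, 3]` and inner box `[-2, 2]` in every coordinate of
`ℝ^{n × m}`. [folklore] -/
def refBox (n m : ℕ) : BoxData n m where
  l := fun _ => -3
  u := fun _ => 3
  l' := fun _ => -2
  u' := fun _ => 2
  hl := fun _ => by norm_num
  hl' := fun _ => by norm_num
  hu := fun _ => by norm_num

/-- The lattice vector `a(n) ∈ Eⁿ` of a multi-index `n ∈ ℤ^{n × m}`: `a(n)ᵢ = Λ⁻¹(n⌊i)`. [folklore] -/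
def latVec (nn : Fin n × Fin m → ℤ) : Fin n → E := fun i => Λ.symm (intVec (BoxData.block nn i))

omit [FiniteDimensional ℝ E] in
/-- Unfolding of `latVec`. [folklore] -/
@[simp]
theorem latVec_apply (nn : Fin n × Fin m → ℤ) (i : Fin n) :
    latVec Λ nn i = Λ.symm (intVec (BoxData.block nn i)) := rfl

omit [FiniteDimensional ℝ E] in
/-- `|n_{ic}| ≤ ‖Λ‖ ‖a(n)‖`. [folklore] -/
theorem abs_le_norm_mul_norm_latVec (nn : Fin n × Fin m → ℤ) (i : Fin n) (c : Fin m) :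
    |(nn (i, c) : ℝ)| ≤ ‖(Λ : E →L[ℝ] EuclideanSpace ℝ (Fin m))‖ * ‖latVec Λ nn‖ := by
  have h := abs_coord_le Λ (le_refl ‖latVec Λ nn‖) i c
  rwa [latVec_apply, ContinuousLinearEquiv.apply_symm_apply, intVec_apply, BoxData.block_apply] at h

omit [FiniteDimensional ℝ E] in
/-- **The summable weights dominate the decay in the lattice vector**:
`1 ≤ ((1 + ‖Λ‖)(1 + ‖a(n)‖))^{2nm} ∏_{ic} (1 + |n_{ic}|)⁻²`. [folklore] -/
theorem one_le_weight_mul (nn : Fin n × Fin m → ℤ) :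
    (1 : ℝ) ≤ ((1 + ‖(Λ : E →L[ℝ] EuclideanSpace ℝ (Fin m))‖) * (1 + ‖latVec Λ nn‖)) ^ (2 * (n * m)) *
      ∏ ic, ((1 + |(nn ic : ℝ)|) ^ 2)⁻¹ := by
  set L : ℝ := ‖(Λ : E →L[ℝ] EuclideanSpace ℝ (Fin m))‖ with hL
  set A : ℝ := ‖latVec Λ nn‖ with hA
  have hL0 : 0 ≤ L := norm_nonneg _
  have hA0 : 0 ≤ A := norm_nonneg _
  have hprod_pos : 0 < ∏ ic, (1 + |(nn ic : ℝ)|) ^ 2 := Finset.prod_pos fun ic _ => by positivity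
  rw [Finset.prod_inv_distrib, ← div_eq_mul_inv, le_div_iff₀ hprod_pos, one_mul]
  calc ∏ ic, (1 + |(nn ic : ℝ)|) ^ 2 ≤ ∏ _ic : Fin n × Fin m, ((1 + L) * (1 + A)) ^ 2 := by
        refine Finset.prod_le_prod (fun ic _ => by positivity) fun ic _ => ?_
        have h1 : |(nn ic : ℝ)| ≤ L * A := abs_le_norm_mul_norm_latVec Λ nn ic.1 ic.2
        have h2 : 1 + |(nn ic : ℝ)| ≤ (1 + L) * (1 + A) := by nlinarith
        exact pow_le_pow_left₀ (by positivity) h2 2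
    _ = ((1 + L) * (1 + A)) ^ (2 * (n * m)) := by
        rw [Finset.prod_const, Finset.card_univ, Fintype.card_prod, Fintype.card_fin,
          Fintype.card_fin, ← pow_mul]

/-- **Translating the arguments of a multilinear form**:
`(translateForm M a)(h) = M(h₁(· - a₁), …, hₙ(· - aₙ))`. [folklore] -/
def translateForm (Mc : MultilinearMap ℂ (fun _ : Fin n => 𝓢(E, ℂ)) ℂ) (a : Fin n → E) :
    MultilinearMap ℂ (fun _ : Fin n => 𝓢(E, ℂ)) ℂ :=
  Mc.compLinearMap fun i =>
    ((SchwartzMap.compSubConstCLM ℂ (a i) : 𝓢(E, ℂ) →L[ℂ] 𝓢(E, ℂ)) : 𝓢(E, ℂ) →ₗ[ℂ] 𝓢(E, ℂ))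

omit [FiniteDimensional ℝ E] in
/-- Unfolding of `translateForm`. [folklore] -/
@[simp]
theorem translateForm_apply (Mc : MultilinearMap ℂ (fun _ : Fin n => 𝓢(E, ℂ)) ℂ) (a : Fin n → E)
    (h : Fin n → 𝓢(E, ℂ)) :
    translateForm Mc a h = Mc fun i => SchwartzMap.compSubConstCLM ℂ (a i) (h i) := rfl

omit [FiniteDimensional ℝ E] in
/-- Translated forms of a continuous form are continuous. [folklore] -/
theorem continuous_translateForm {Mc : MultilinearMap ℂ (fun _ : Fin n => 𝓢(E, ℂ)) ℂ}
    (hMc : Continuous Mc) (a : Fin n → E) : Continuous (translateForm Mc a) := by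
  change Continuous fun h : Fin n → 𝓢(E, ℂ) => Mc fun i => SchwartzMap.compSubConstCLM ℂ (a i) (h i)
  exact hMc.comp (continuous_pi fun i =>
    (SchwartzMap.compSubConstCLM ℂ (a i)).continuous.comp (continuous_apply i))

omit [FiniteDimensional ℝ E] in
/-- **Seminorm bounds of the translated forms grow polynomially in the translation**: if `M` is
bounded by `s` with constant `C`, then `translateForm M a` is bounded by some `s'` with constant
`C' (1 + ‖a‖)^k`, uniformly in `a` (`exists_bound_seminorm_compSubConstCLM` slotwise). [folklore] -/
theorem exists_isBoundedBySeminorms_translateForm {s : Finset (ℕ × ℕ)}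
    {Mc : MultilinearMap ℂ (fun _ : Fin n => 𝓢(E, ℂ)) ℂ} {C : ℝ} (hb : Mc.IsBoundedBySeminorms s C) :
    ∃ (s' : Finset (ℕ × ℕ)) (C' : ℝ) (k : ℕ), 0 ≤ C' ∧
      ∀ a : Fin n → E, (translateForm Mc a).IsBoundedBySeminorms s' (C' * (1 + ‖a‖) ^ k) := by
  obtain ⟨C₁, k, s', hC₁, h₁⟩ := exists_bound_seminorm_compSubConstCLM ℂ (V := E) (F := ℂ) s
  have hC : 0 ≤ C := hb.1
  refine ⟨s', C * C₁ ^ n, k * n, by positivity, fun a => ⟨by positivity, fun h => ?_⟩⟩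
  rw [translateForm_apply]
  have ha : ∀ i, ‖a i‖ ≤ ‖a‖ := fun i => norm_le_pi_norm a i
  calc ‖Mc fun i => SchwartzMap.compSubConstCLM ℂ (a i) (h i)‖
      ≤ C * ∏ i, (s.sup (schwartzSeminormFamily ℂ E ℂ)) (SchwartzMap.compSubConstCLM ℂ (a i) (h i)) :=
        hb.2 _
    _ ≤ C * ∏ i, (C₁ * (1 + ‖a‖) ^ k * (s'.sup (schwartzSeminormFamily ℂ E ℂ)) (h i)) := by
        refine mul_le_mul_of_nonneg_left
          (Finset.prod_le_prod (fun i _ => apply_nonneg _ _) fun i _ => ?_) hC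
        calc _ ≤ C₁ * (1 + ‖a i‖) ^ k * (s'.sup (schwartzSeminormFamily ℂ E ℂ)) (h i) := h₁ (a i) (h i)
          _ ≤ C₁ * (1 + ‖a‖) ^ k * (s'.sup (schwartzSeminormFamily ℂ E ℂ)) (h i) := by
              gcongr; exact ha i
    _ = C * C₁ ^ n * (1 + ‖a‖) ^ (k * n) * ∏ i, (s'.sup (schwartzSeminormFamily ℂ E ℂ)) (h i) := by
        rw [Finset.prod_mul_distrib, Finset.prod_const, Finset.card_univ, Fintype.card_fin, mul_pow,
          ← pow_mul]
        ring

/-- The complexified lattice bump `η_β : E → ℂ`. [folklore] -/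
def bumpOne (β : Fin m → ℤ) (y : E) : ℂ := ((latticeBump Λ β y : ℝ) : ℂ)

omit [FiniteDimensional ℝ E] in
/-- `bumpOne` is the composition of the coercion `ℝ → ℂ` with `latticeBump`. [folklore] -/
theorem bumpOne_eq_comp (β : Fin m → ℤ) : bumpOne Λ β = (fun r : ℝ => (r : ℂ)) ∘ latticeBump Λ β := rfl

omit [FiniteDimensional ℝ E] in
/-- `η_β` is smooth. [folklore] -/
theorem contDiff_bumpOne (β : Fin m → ℤ) : ContDiff ℝ ∞ (bumpOne Λ β) :=
  contDiff_ofReal_comp ℂ (contDiff_latticeBump Λ β)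

/-- `η_β` has compact support. [folklore] -/
theorem hasCompactSupport_bumpOne (β : Fin m → ℤ) : HasCompactSupport (bumpOne Λ β) := by
  rw [bumpOne_eq_comp]
  exact (hasCompactSupport_latticeBump Λ β).comp_left Complex.ofReal_zero

/-- `η_β` has temperate growth. [folklore] -/
theorem hasTemperateGrowth_bumpOne (β : Fin m → ℤ) : (bumpOne Λ β).HasTemperateGrowth :=
  (hasCompactSupport_bumpOne Λ β).hasTemperateGrowth (contDiff_bumpOne Λ β)

omit [FiniteDimensional ℝ E] in
/-- `η_0 · g` is supported in the inner blocks `{x | Λ(x)_c ∈ [-2, 2]}` of the reference box. [folklore] -/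
theorem tsupport_smulLeftCLM_bumpOne_subset (g : 𝓢(E, ℂ)) (i : Fin n) :
    tsupport ((SchwartzMap.smulLeftCLM ℂ (bumpOne Λ 0) g : 𝓢(E, ℂ)) : E → ℂ) ⊆
      {x | ∀ c, (Λ x) c ∈ Icc ((refBox n m).l' (i, c)) ((refBox n m).u' (i, c))} := by
  intro x hx c
  have h1 : x ∈ tsupport (bumpOne Λ 0) := (SchwartzMap.tsupport_smulLeftCLM_subset (bumpOne Λ 0) g hx).2
  rw [bumpOne_eq_comp] at h1
  have h2 : x ∈ tsupport (latticeBump Λ (0 : Fin m → ℤ)) :=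
    tsupport_comp_subset (g := fun r : ℝ => (r : ℂ)) Complex.ofReal_zero _ h1
  have h3 := tsupport_latticeBump_subset Λ 0 h2 c
  simp only [Pi.zero_apply, Int.cast_zero, sub_zero, mem_Icc] at h3
  change (Λ x) c ∈ Icc (-2 : ℝ) 2
  constructor <;> linarith [h3.1, h3.2]

/-- The cutoff `χ₀(v) = ∏ᵢ η₀(vᵢ)` on `Eⁿ`. [folklore] -/
def cutoffPi (v : Fin n → E) : ℂ := ∏ i, bumpOne Λ 0 (v i)

omit [FiniteDimensional ℝ E] in
/-- `χ₀` is smooth. [folklore] -/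
theorem contDiff_cutoffPi : ContDiff ℝ ∞ (cutoffPi (n := n) Λ) := by
  unfold cutoffPi
  exact contDiff_prod fun i _ => (contDiff_bumpOne Λ 0).comp (contDiff_apply ℝ E i)

/-- `χ₀` has compact support. [folklore] -/
theorem hasCompactSupport_cutoffPi : HasCompactSupport (cutoffPi (n := n) Λ) := by
  refine HasCompactSupport.intro (K := Set.pi Set.univ fun _ : Fin n => tsupport (bumpOne Λ (0 : Fin m → ℤ)))
    (isCompact_univ_pi fun _ => hasCompactSupport_bumpOne Λ 0) fun v hv => ?_
  simp only [Set.mem_univ_pi, not_forall] at hv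
  obtain ⟨i, hi⟩ := hv
  exact Finset.prod_eq_zero (Finset.mem_univ i) (image_eq_zero_of_notMem_tsupport hi)

/-- `χ₀` has temperate growth. [folklore] -/
theorem hasTemperateGrowth_cutoffPi : (cutoffPi (n := n) Λ).HasTemperateGrowth :=
  (hasCompactSupport_cutoffPi Λ).hasTemperateGrowth (contDiff_cutoffPi Λ)

/-- **Localisation**: `localise a F = χ₀ · F(· + a)`, a continuous linear map of `𝓢(Eⁿ, ℂ)`. [folklore] -/
def localise (a : Fin n → E) : 𝓢((Fin n → E), ℂ) →L[ℂ] 𝓢((Fin n → E), ℂ) :=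
  (SchwartzMap.smulLeftCLM ℂ (cutoffPi Λ)).comp (SchwartzMap.compSubConstCLM ℂ (-a))

/-- Unfolding of `localise`. [folklore] -/
theorem localise_apply (a : Fin n → E) (F : 𝓢((Fin n → E), ℂ)) (v : Fin n → E) :
    localise Λ a F v = cutoffPi Λ v * F (v + a) := by
  simp only [localise, ContinuousLinearMap.coe_comp, Function.comp_apply,
    SchwartzMap.smulLeftCLM_apply_apply (hasTemperateGrowth_cutoffPi Λ),
    SchwartzMap.compSubConstCLM_apply, smul_eq_mul, sub_neg_eq_add]

/-- **Localisation of a tensor product is a tensor product**: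
`χ₀ · (⊗g)(· + a) = ⊗ᵢ (η₀ · gᵢ(· + aᵢ))`. [folklore] -/
theorem localise_tensorFin (a : Fin n → E) (g : Fin n → 𝓢(E, ℂ)) :
    localise Λ a (SchwartzMap.tensorFin n g) = SchwartzMap.tensorFin n fun i =>
      SchwartzMap.smulLeftCLM ℂ (bumpOne Λ 0) (SchwartzMap.compSubConstCLM ℂ (-a i) (g i)) := by
  ext v
  rw [localise_apply, SchwartzMap.tensorFin_apply, SchwartzMap.tensorFin_apply, cutoffPi,
    ← Finset.prod_mul_distrib]
  refine Finset.prod_congr rfl fun i _ => ?_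
  rw [SchwartzMap.smulLeftCLM_apply_apply (hasTemperateGrowth_bumpOne Λ 0),
    SchwartzMap.compSubConstCLM_apply, smul_eq_mul, Pi.add_apply, sub_neg_eq_add]

/-- Translating back the localised block functions gives the bumps `η_{n⌊i} · gᵢ`. [folklore] -/
theorem compSubConstCLM_smulLeftCLM_bumpOne (nn : Fin n × Fin m → ℤ) (i : Fin n) (g : 𝓢(E, ℂ)) :
    SchwartzMap.compSubConstCLM ℂ (latVec Λ nn i)
        (SchwartzMap.smulLeftCLM ℂ (bumpOne Λ 0) (SchwartzMap.compSubConstCLM ℂ (-latVec Λ nn i) g)) =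
      SchwartzMap.smulLeftCLM ℂ (bumpOne Λ (BoxData.block nn i)) g := by
  ext y
  rw [SchwartzMap.compSubConstCLM_apply,
    SchwartzMap.smulLeftCLM_apply_apply (hasTemperateGrowth_bumpOne Λ 0),
    SchwartzMap.compSubConstCLM_apply,
    SchwartzMap.smulLeftCLM_apply_apply (hasTemperateGrowth_bumpOne Λ _), sub_neg_eq_add,
    sub_add_cancel, bumpOne, bumpOne, latVec_apply, ← latticeBump_eq_comp_sub]

/-! ### E. The kernel functional: definition, bound and reproduction on tensor products -/

variable {Mc : MultilinearMap ℂ (fun _ : Fin n => 𝓢(E, ℂ)) ℂ}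

omit [FiniteDimensional ℝ E] in
/-- A continuous form has translated forms bounded polynomially in the translation. [folklore] -/
theorem exists_translate_bound (hMc : Continuous Mc) :
    ∃ (s' : Finset (ℕ × ℕ)) (C' : ℝ) (k : ℕ), 0 ≤ C' ∧
      ∀ a : Fin n → E, (translateForm Mc a).IsBoundedBySeminorms s' (C' * (1 + ‖a‖) ^ k) := by
  obtain ⟨s, C, hb⟩ := Mc.exists_isBoundedBySeminorms hMc
  exact exists_isBoundedBySeminorms_translateForm hb

/-- The finite family of seminorms bounding all translated forms (chosen). [folklore] -/
def trSet (hMc : Continuous Mc) : Finset (ℕ × ℕ) := (exists_translate_bound hMc).choose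

/-- The constant in the bound of the translated forms (chosen). [folklore] -/
def trConst (hMc : Continuous Mc) : ℝ := (exists_translate_bound hMc).choose_spec.choose

/-- The exponent in the bound of the translated forms (chosen). [folklore] -/
def trExp (hMc : Continuous Mc) : ℕ := (exists_translate_bound hMc).choose_spec.choose_spec.choose

omit [FiniteDimensional ℝ E] in
/-- `trConst ≥ 0`. [folklore] -/
theorem trConst_nonneg (hMc : Continuous Mc) : 0 ≤ trConst hMc :=
  (exists_translate_bound hMc).choose_spec.choose_spec.choose_spec.1

omit [FiniteDimensional ℝ E] in
/-- The defining property of `trSet`, `trConst`, `trExp`. [folklore] -/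
theorem trSpec (hMc : Continuous Mc) (a : Fin n → E) :
    (translateForm Mc a).IsBoundedBySeminorms (trSet hMc) (trConst hMc * (1 + ‖a‖) ^ trExp hMc) :=
  (exists_translate_bound hMc).choose_spec.choose_spec.choose_spec.2 a

/-- **The terms of the kernel series**: `T_n(F) = T_{B₀}[M ∘ τ_{a(n)}](χ₀ · F(· + a(n)))`, the
local functional of the reference box for the translated form, applied to the localised
translate of `F`. [folklore] -/
def kernelTerm (hMc : Continuous Mc) (F : 𝓢((Fin n → E), ℂ)) (nn : Fin n × Fin m → ℤ) : ℂ :=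
  (refBox n m).boxFunctional Λ (trSpec hMc (latVec Λ nn)) (localise Λ (latVec Λ nn) F)

/-- The terms are additive in `F`. [folklore] -/
theorem kernelTerm_add (hMc : Continuous Mc) (F G : 𝓢((Fin n → E), ℂ)) (nn : Fin n × Fin m → ℤ) :
    kernelTerm Λ hMc (F + G) nn = kernelTerm Λ hMc F nn + kernelTerm Λ hMc G nn := by
  simp only [kernelTerm, map_add]

/-- The terms are homogeneous in `F`. [folklore] -/
theorem kernelTerm_smul (hMc : Continuous Mc) (c : ℂ) (F : 𝓢((Fin n → E), ℂ))
    (nn : Fin n × Fin m → ℤ) : kernelTerm Λ hMc (c • F) nn = c * kernelTerm Λ hMc F nn := by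
  simp only [kernelTerm, map_smul, smul_eq_mul]

/-- **The summable bound of the terms**: `|T_n(F)| ≤ D · ∏_{ic} (1 + |n_{ic}|)⁻² · q(F)` for a
finite supremum `q` of Schwartz seminorms (local bound `norm_boxFunctional_le` with the
polynomial growth `trSpec` of the translated forms, against the super-polynomial decay
`exists_bound_sup_seminorm_smulLeftCLM_compSubConstCLM` of the localised translates, and
`one_le_weight_mul`). [folklore] -/
theorem kernelTerm_bound (hMc : Continuous Mc) :
    ∃ (s : Finset (ℕ × ℕ)) (D : ℝ), 0 ≤ D ∧ ∀ (F : 𝓢((Fin n → E), ℂ)) (nn : Fin n × Fin m → ℤ),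
      ‖kernelTerm Λ hMc F nn‖ ≤
        D * (∏ ic, ((1 + |(nn ic : ℝ)|) ^ 2)⁻¹) * (s.sup (schwartzSeminormFamily ℂ (Fin n → E) ℂ)) F := by
  set B : BoxData n m := refBox n m with hB
  set s' : Finset (ℕ × ℕ) := trSet hMc with hs'
  set C' : ℝ := trConst hMc with hC'
  set k : ℕ := trExp hMc with hk
  set K : ℝ := B.bfConst Λ s' with hK
  set N : ℕ := k + 2 * (n * m) with hN
  have hC'0 : 0 ≤ C' := trConst_nonneg hMc
  have hK0 : 0 ≤ K := B.bfConst_nonneg Λ s'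
  obtain ⟨C₂, s'', hC₂, h₂⟩ := exists_bound_sup_seminorm_smulLeftCLM_compSubConstCLM ℂ (F := ℂ)
    (contDiff_cutoffPi (n := n) Λ) (hasCompactSupport_cutoffPi Λ) (B.bfSet Λ s') N
  set L : ℝ := ‖(Λ : E →L[ℝ] EuclideanSpace ℝ (Fin m))‖ with hL
  refine ⟨s'', (1 + L) ^ (2 * (n * m)) * (C' * K * C₂), by positivity, fun F nn => ?_⟩
  set a : Fin n → E := latVec Λ nn with ha
  set w : ℝ := ∏ ic, ((1 + |(nn ic : ℝ)|) ^ 2)⁻¹ with hw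
  have hw0 : 0 ≤ w := Finset.prod_nonneg fun ic _ => by positivity
  set qF : ℝ := (s''.sup (schwartzSeminormFamily ℂ (Fin n → E) ℂ)) F with hqF
  set qloc : ℝ := ((B.bfSet Λ s').sup (schwartzSeminormFamily ℂ (Fin n → E) ℂ)) (localise Λ a F)
    with hqloc
  have hqloc0 : 0 ≤ qloc := apply_nonneg _ _
  -- (1) the local bound
  have h1 : ‖kernelTerm Λ hMc F nn‖ ≤ C' * (1 + ‖a‖) ^ k * K * qloc :=
    B.norm_boxFunctional_le Λ (trSpec hMc a) (localise Λ a F)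
  -- (2) the localisation bound
  have h2 : qloc * (1 + ‖a‖) ^ N ≤ C₂ * qF := by
    have := h₂ (-a) F
    rwa [norm_neg] at this
  -- (3) combine
  have h3 : ‖kernelTerm Λ hMc F nn‖ * (1 + ‖a‖) ^ (2 * (n * m)) ≤ C' * K * C₂ * qF := by
    calc ‖kernelTerm Λ hMc F nn‖ * (1 + ‖a‖) ^ (2 * (n * m))
        ≤ (C' * (1 + ‖a‖) ^ k * K * qloc) * (1 + ‖a‖) ^ (2 * (n * m)) := by gcongr
      _ = C' * K * (qloc * (1 + ‖a‖) ^ N) := by rw [hN, pow_add]; ring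
      _ ≤ C' * K * (C₂ * qF) := by gcongr
      _ = C' * K * C₂ * qF := by ring
  -- (4) weights
  have h4 := one_le_weight_mul (n := n) Λ nn
  calc ‖kernelTerm Λ hMc F nn‖ = ‖kernelTerm Λ hMc F nn‖ * 1 := (mul_one _).symm
    _ ≤ ‖kernelTerm Λ hMc F nn‖ * (((1 + L) * (1 + ‖a‖)) ^ (2 * (n * m)) * w) := by gcongr
    _ = (1 + L) ^ (2 * (n * m)) * w * (‖kernelTerm Λ hMc F nn‖ * (1 + ‖a‖) ^ (2 * (n * m))) := by
        rw [mul_pow]; ring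
    _ ≤ (1 + L) ^ (2 * (n * m)) * w * (C' * K * C₂ * qF) := by gcongr
    _ = (1 + L) ^ (2 * (n * m)) * (C' * K * C₂) * w * qF := by ring

/-- The terms are absolutely summable. [folklore] -/
theorem summable_norm_kernelTerm (hMc : Continuous Mc) (F : 𝓢((Fin n → E), ℂ)) :
    Summable fun nn : Fin n × Fin m → ℤ => ‖kernelTerm Λ hMc F nn‖ := by
  obtain ⟨s, D, hD, h⟩ := kernelTerm_bound Λ hMc
  exact Summable.of_nonneg_of_le (fun _ => norm_nonneg _) (fun nn => h F nn)
    ((summable_pi_inv_one_add_abs_sq.mul_left D).mul_right _)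

/-- **The kernel functional** of a continuous multilinear form `M` on `𝓢(E, ℂ)ⁿ`:
`T(F) = ∑_{n ∈ ℤ^{n×m}} T_{B₀}[M ∘ τ_{a(n)}](χ₀ · F(· + a(n)))`, a continuous linear functional
on `𝓢(Eⁿ, ℂ)` (`SchwartzMap.mkCLMtoNormedSpace` with the bound of `kernelTerm_bound`). It
extends `M` from tensor products (`kernelFunctional_tensorFin`). [folklore] -/
def kernelFunctional (hMc : Continuous Mc) : 𝓢((Fin n → E), ℂ) →L[ℂ] ℂ :=
  SchwartzMap.mkCLMtoNormedSpace (fun F => ∑' nn : Fin n × Fin m → ℤ, kernelTerm Λ hMc F nn)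
    (fun F G => by
      change ∑' nn, kernelTerm Λ hMc (F + G) nn = ∑' nn, kernelTerm Λ hMc F nn + ∑' nn, kernelTerm Λ hMc G nn
      rw [← (summable_norm_kernelTerm Λ hMc F).of_norm.tsum_add (summable_norm_kernelTerm Λ hMc G).of_norm]
      exact tsum_congr fun nn => kernelTerm_add Λ hMc F G nn)
    (fun c F => by
      change ∑' nn, kernelTerm Λ hMc (c • F) nn = c • ∑' nn, kernelTerm Λ hMc F nn
      rw [smul_eq_mul, ← tsum_mul_left]
      exact tsum_congr fun nn => kernelTerm_smul Λ hMc c F nn)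
    (by
      obtain ⟨s, D, hD, h⟩ := kernelTerm_bound Λ hMc
      have hS := summable_pi_inv_one_add_abs_sq (ι := Fin n × Fin m)
      set S : ℝ := ∑' nn : Fin n × Fin m → ℤ, ∏ ic, ((1 + |(nn ic : ℝ)|) ^ 2)⁻¹ with hSdef
      have hS0 : 0 ≤ S := tsum_nonneg fun nn => Finset.prod_nonneg fun ic _ => by positivity
      refine ⟨s, D * S, by positivity, fun F => ?_⟩
      calc ‖∑' nn, kernelTerm Λ hMc F nn‖ ≤ ∑' nn, ‖kernelTerm Λ hMc F nn‖ :=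
            norm_tsum_le_tsum_norm (summable_norm_kernelTerm Λ hMc F)
        _ ≤ ∑' nn : Fin n × Fin m → ℤ, D * (∏ ic, ((1 + |(nn ic : ℝ)|) ^ 2)⁻¹) *
              (s.sup (schwartzSeminormFamily ℂ (Fin n → E) ℂ)) F :=
            (summable_norm_kernelTerm Λ hMc F).tsum_le_tsum (h F) ((hS.mul_left D).mul_right _)
        _ = D * S * (s.sup (schwartzSeminormFamily ℂ (Fin n → E) ℂ)) F := by
            rw [tsum_mul_right, tsum_mul_left])

/-- Unfolding of `kernelFunctional`. [folklore] -/
theorem kernelFunctional_apply (hMc : Continuous Mc) (F : 𝓢((Fin n → E), ℂ)) :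
    kernelFunctional Λ hMc F = ∑' nn : Fin n × Fin m → ℤ, kernelTerm Λ hMc F nn := rfl

/-- The kernel functional is the sum of its series. [folklore] -/
theorem hasSum_kernelFunctional (hMc : Continuous Mc) (F : 𝓢((Fin n → E), ℂ)) :
    HasSum (fun nn : Fin n × Fin m → ℤ => kernelTerm Λ hMc F nn) (kernelFunctional Λ hMc F) :=
  (summable_norm_kernelTerm Λ hMc F).of_norm.hasSum

/-- **The terms on a tensor product**: `T_n(g₁ ⊗ ⋯ ⊗ gₙ) = M(η_{n⌊1} g₁, …, η_{n⌊n} gₙ)`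
(`localise_tensorFin`, the local reproduction `boxFunctional_tensorFin` for the translated form,
and translating back, `compSubConstCLM_smulLeftCLM_bumpOne`). [folklore] -/
theorem kernelTerm_tensorFin (hMc : Continuous Mc) (g : Fin n → 𝓢(E, ℂ)) (nn : Fin n × Fin m → ℤ) :
    kernelTerm Λ hMc (SchwartzMap.tensorFin n g) nn =
      Mc fun i => SchwartzMap.smulLeftCLM ℂ (bumpOne Λ (BoxData.block nn i)) (g i) := by
  rw [kernelTerm, localise_tensorFin,
    (refBox n m).boxFunctional_tensorFin Λ (trSpec hMc _) (continuous_translateForm hMc _) _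
      (fun i => tsupport_smulLeftCLM_bumpOne_subset Λ _ i), translateForm_apply]
  congr 1
  funext i
  exact compSubConstCLM_smulLeftCLM_bumpOne Λ nn i (g i)

/-- Summing the bumps over a discrete cube gives the window: `∑_{β ∈ [-R,R]ᵐ} η_β · g = W_R · g`. [folklore] -/
theorem sum_latticeCube_smulLeftCLM_bumpOne (R : ℕ) (g : 𝓢(E, ℂ)) :
    ∑ β ∈ latticeCube m R, SchwartzMap.smulLeftCLM ℂ (bumpOne Λ β) g =
      SchwartzMap.smulLeftCLM ℂ (fun y => ((latticeWindow Λ R y : ℝ) : ℂ)) g := by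
  have hW : (fun y => ((latticeWindow Λ R y : ℝ) : ℂ)) = fun y => ∑ β ∈ latticeCube m R, bumpOne Λ β y := by
    funext y
    rw [← sum_latticeCube_latticeBump Λ R y, Complex.ofReal_sum]
    rfl
  calc ∑ β ∈ latticeCube m R, SchwartzMap.smulLeftCLM ℂ (bumpOne Λ β) g
      = (∑ β ∈ latticeCube m R, SchwartzMap.smulLeftCLM ℂ (bumpOne Λ β)) g := by
        rw [FunLike.coe_sum, Finset.sum_apply]
    _ = SchwartzMap.smulLeftCLM ℂ (fun y => ∑ β ∈ latticeCube m R, bumpOne Λ β y) g := by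
        rw [SchwartzMap.smulLeftCLM_sum fun β _ => hasTemperateGrowth_bumpOne Λ β]
    _ = SchwartzMap.smulLeftCLM ℂ (fun y => ((latticeWindow Λ R y : ℝ) : ℂ)) g := by rw [hW]

/-- Partial sums of the kernel series on a tensor product over the block-cubes:
`∑_{n : n⌊i ∈ [-R,R]ᵐ} T_n(⊗g) = M(W_R g₁, …, W_R gₙ)`. [folklore] -/
theorem sum_kernelTerm_tensorFin (hMc : Continuous Mc) (g : Fin n → 𝓢(E, ℂ)) (R : ℕ) :
    ∑ nn ∈ (Fintype.piFinset fun _ : Fin n => latticeCube m R).map (BoxData.nnEquiv n m).toEmbedding,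
        kernelTerm Λ hMc (SchwartzMap.tensorFin n g) nn =
      Mc fun i => SchwartzMap.smulLeftCLM ℂ (fun y => ((latticeWindow Λ R y : ℝ) : ℂ)) (g i) := by
  rw [Finset.sum_map]
  simp only [Equiv.coe_toEmbedding, kernelTerm_tensorFin, BoxData.block_nnEquiv]
  rw [← MultilinearMap.map_sum_finset Mc (fun i β => SchwartzMap.smulLeftCLM ℂ (bumpOne Λ β) (g i))
    (fun _ : Fin n => latticeCube m R)]
  congr 1
  funext i
  exact sum_latticeCube_smulLeftCLM_bumpOne Λ R (g i)

/-- **The kernel functional extends the multilinear form**: `T(g₁ ⊗ ⋯ ⊗ gₙ) = M(g₁, …, gₙ)`.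
Both sides are the limit of `M(W_R g₁, …, W_R gₙ)` as `R → ∞`: the left by summing the series over
the block-cubes (`sum_kernelTerm_tensorFin`), the right by continuity of `M` and `W_R g → g`
(`tendsto_latticeWindow_smul`). [folklore] -/
theorem kernelFunctional_tensorFin (hMc : Continuous Mc) (g : Fin n → 𝓢(E, ℂ)) :
    kernelFunctional Λ hMc (SchwartzMap.tensorFin n g) = Mc g := by
  have h1 : Tendsto (fun R : ℕ => Mc fun i =>
      SchwartzMap.smulLeftCLM ℂ (fun y => ((latticeWindow Λ R y : ℝ) : ℂ)) (g i)) atTop (𝓝 (Mc g)) :=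
    (hMc.tendsto g).comp (tendsto_pi_nhds.2 fun i => tendsto_latticeWindow_smul Λ ℂ (g i))
  have h2 : Tendsto (fun R : ℕ => Mc fun i =>
      SchwartzMap.smulLeftCLM ℂ (fun y => ((latticeWindow Λ R y : ℝ) : ℂ)) (g i)) atTop
      (𝓝 (kernelFunctional Λ hMc (SchwartzMap.tensorFin n g))) := by
    simp only [← sum_kernelTerm_tensorFin Λ hMc g]
    exact (hasSum_kernelFunctional Λ hMc (SchwartzMap.tensorFin n g)).comp
      (BoxData.tendsto_map_piFinset_latticeCube (n := n) (m := m))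
  exact tendsto_nhds_unique h2 h1

end Global

/-! ### F. The kernel theorem -/

section Kernel

variable {E : Type*} [NormedAddCommGroup E] [NormedSpace ℝ E] [FiniteDimensional ℝ E] {n : ℕ}

/-- **Schwartz kernel theorem for multilinear forms.** Every (jointly) continuous complex
`n`-linear form `M` on `𝓢(E, ℂ)ⁿ`, `E` a finite-dimensional real normed space, is the restriction
to tensor products of a unique continuous linear functional `T` on `𝓢(Eⁿ, ℂ)`:
`T(g₁ ⊗ ⋯ ⊗ gₙ) = M(g₁, …, gₙ)`. Existence: `kernelFunctional` in linear coordinates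
`toEuclidean : E ≃L[ℝ] ℝᵐ`; uniqueness: density of the span of tensor products of real test
functions (`denseSpan_tensorProducts_holds`, `SchwingerFamily.ext_of_denseSpan`). Reed–Simon I, Thm V.12
(kernel or nuclear theorem, bilinear forms on `𝒮(ℝⁿ) × 𝒮(ℝᵐ)`), extended to multilinear forms in
Problem 35 of Ch. V; here for jointly continuous forms (for Fréchet spaces separate continuity
implies joint continuity, ibid.). [cite: ReedSimonI1980, Thm V.12 and Problem V.35] -/
theorem existsUnique_schwartzKernel
    (Mc : MultilinearMap ℂ (fun _ : Fin n => 𝓢(E, ℂ)) ℂ) (hMc : Continuous Mc) :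
    ∃! T : 𝓢((Fin n → E), ℂ) →L[ℂ] ℂ, ∀ g : Fin n → 𝓢(E, ℂ), T (SchwartzMap.tensorFin n g) = Mc g := by
  refine ⟨kernelFunctional toEuclidean hMc, kernelFunctional_tensorFin toEuclidean hMc, fun T hT => ?_⟩
  refine SchwingerFamily.ext_of_denseSpan denseSpan_tensorProducts_holds fun f F hF => ?_
  rw [(hF.unique (isTensorOf_tensorFin _) : F = SchwartzMap.tensorFin n fun i => ofRealTest (f i)), hT,
    kernelFunctional_tensorFin]

/-- **Schwartz kernel theorem, real multilinear forms.** A continuous real `n`-linear form `M` on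
`𝓢(E, ℝ)ⁿ` is the restriction to (complexified) tensor products of a unique continuous linear
functional `T` on `𝓢(Eⁿ, ℂ)`: `T(f₁ ⊗ ⋯ ⊗ fₙ) = M(f₁, …, fₙ)` for real `fᵢ`, in the witness form
`IsTensorOf` (complexify `M`, `multilinearComplexify`, and apply the complex statement). [cite: ReedSimonI1980, Thm V.12 and Problem V.35] -/
theorem existsUnique_schwartzKernel_real
    (M : MultilinearMap ℝ (fun _ : Fin n => 𝓢(E, ℝ)) ℝ) (hM : Continuous M) :
    ∃! T : 𝓢((Fin n → E), ℂ) →L[ℂ] ℂ, ∀ (f : Fin n → 𝓢(E, ℝ)) (F : 𝓢((Fin n → E), ℂ)),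
      IsTensorOf F (fun i => ofRealTest (f i)) → T F = (M f : ℂ) := by
  obtain ⟨T, hT, -⟩ := existsUnique_schwartzKernel (multilinearComplexify M)
    (continuous_multilinearComplexify hM)
  refine ⟨T, fun f F hF => ?_, fun T' hT' => ?_⟩
  · rw [(hF.unique (isTensorOf_tensorFin _) : F = SchwartzMap.tensorFin n fun i => ofRealTest (f i)), hT,
      multilinearComplexify_ofRealTest]
  · refine SchwingerFamily.ext_of_denseSpan denseSpan_tensorProducts_holds fun f F hF => ?_
    rw [hT' f F hF, (hF.unique (isTensorOf_tensorFin _) : F = SchwartzMap.tensorFin n fun i => ofRealTest (f i)),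
      hT, multilinearComplexify_ofRealTest]

end Kernel

/-! ### G. The Schwinger functions of a measure: discharge of `existsUnique_schwingerFamilyOf` -/

section Schwinger

open MeasureTheory

variable {E : Type*} [NormedAddCommGroup E] [NormedSpace ℝ E]

/-- **The moment functionals are multilinear**: `(f₁, …, fₙ) ↦ ∫ ∏ᵢ φ(fᵢ) dμ` as a real
`n`-linear form on `𝓢(E, ℝ)ⁿ`, for a finite measure with all moments (linearity of `φ` and of the
integral; the products are integrable, `HasAllMoments.integrable_prod`). [folklore] -/
def momentMultilinear (μ : Measure (FieldConfig E)) [IsFiniteMeasure μ] (hμ : HasAllMoments μ) (n : ℕ) :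
    MultilinearMap ℝ (fun _ : Fin n => 𝓢(E, ℝ)) ℝ where
  toFun f := moment μ n f
  map_update_add' f j x y := by
    have key : ∀ (z : 𝓢(E, ℝ)) (φ : FieldConfig E),
        ∏ i, φ (Function.update f j z i) = φ z * ∏ i ∈ Finset.univ.erase j, φ (f i) := by
      intro z φ
      have h : ∀ i, φ (Function.update f j z i) = Function.update (fun i => φ (f i)) j (φ z) i := by
        intro i
        by_cases hi : i = j
        · subst hi; simp
        · simp [Function.update_of_ne hi]
      rw [Finset.prod_congr rfl fun i _ => h i, Finset.prod_update_of_mem (Finset.mem_univ j),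
        Finset.sdiff_singleton_eq_erase]
    change ∫ φ, ∏ i, φ (Function.update f j (x + y) i) ∂μ =
      ∫ φ, ∏ i, φ (Function.update f j x i) ∂μ + ∫ φ, ∏ i, φ (Function.update f j y i) ∂μ
    rw [← integral_add (hμ.integrable_prod _) (hμ.integrable_prod _)]
    refine integral_congr_ae (ae_of_all _ fun φ => ?_)
    simp only [key, map_add, add_mul]
  map_update_smul' f j c x := by
    have key : ∀ (z : 𝓢(E, ℝ)) (φ : FieldConfig E),
        ∏ i, φ (Function.update f j z i) = φ z * ∏ i ∈ Finset.univ.erase j, φ (f i) := by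
      intro z φ
      have h : ∀ i, φ (Function.update f j z i) = Function.update (fun i => φ (f i)) j (φ z) i := by
        intro i
        by_cases hi : i = j
        · subst hi; simp
        · simp [Function.update_of_ne hi]
      rw [Finset.prod_congr rfl fun i _ => h i, Finset.prod_update_of_mem (Finset.mem_univ j),
        Finset.sdiff_singleton_eq_erase]
    change ∫ φ, ∏ i, φ (Function.update f j (c • x) i) ∂μ = c • ∫ φ, ∏ i, φ (Function.update f j x i) ∂μ
    rw [smul_eq_mul, ← integral_const_mul]
    refine integral_congr_ae (ae_of_all _ fun φ => ?_)
    simp only [key, map_smul, smul_eq_mul, mul_assoc]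

/-- Unfolding of `momentMultilinear`. [folklore] -/
@[simp]
theorem momentMultilinear_apply (μ : Measure (FieldConfig E)) [IsFiniteMeasure μ] (hμ : HasAllMoments μ)
    (n : ℕ) (f : Fin n → 𝓢(E, ℝ)) : momentMultilinear μ hμ n f = moment μ n f := rfl

/-- **Discharge of `existsUnique_schwingerFamilyOf`** (the Schwinger functions of a measure;
Glimm–Jaffe §6.1, Prop. 6.1.4; OS 1973 §3): for a probability law on `𝒮'(E)`, `E`
finite-dimensional, with all moments and jointly continuous moment functionals, there is a unique
Schwinger family `𝔖ₙ ∈ 𝒮'(Eⁿ)` with `𝔖ₙ(f₁ ⊗ ⋯ ⊗ fₙ) = ∫ ∏ᵢ φ(fᵢ) dμ`. Existence: the kernel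
theorem `existsUnique_schwartzKernel_real` applied to the moment forms
`momentMultilinear μ n`; uniqueness: `IsSchwingerFamilyOf.unique` (density of tensor products). [cite: GlimmJaffeQP1987, §6.1 Prop. 6.1.4] -/
theorem existsUnique_schwingerFamilyOf_holds : existsUnique_schwingerFamilyOf (E := E) := by
  intro _ μ _ hμ hcont
  have hM : ∀ n, Continuous (momentMultilinear μ hμ n) := fun n => hcont n
  choose T hT using fun n =>
    (existsUnique_schwartzKernel_real (momentMultilinear μ hμ n) (hM n)).exists
  have hS : IsSchwingerFamilyOf μ T := fun n f F hF => hT n f F hF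
  exact ⟨T, hS, fun S' hS' => IsSchwingerFamilyOf.unique hS' hS⟩

end Schwinger

end Literature.MathematicalPhysics.QuantumLattice
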